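import Literature.NumberTheory.EllipticCurves.ZpExtensionEisensteinDVRSetting
import Literature.NumberTheory.EllipticCurves.ZpExtensionEisensteinTwistRestrictedDualityInstanceProofs
import Literature.NumberTheory.EllipticCurves.ZpExtensionEisensteinTwistDualityFormNondegenerateProofs
import HarnessLib

/-!
# The module-level isotropy `hOrth` of H.4 at `v ∣ p` for the instantiated (Weil–τ) H.4 data (theorems only)

`Proofs` file (theorems only; no definition, no named fact, no instance, no `sorry`).  Topic `NumberTheory/EllipticCurves`
(D1 road of cell `pub/bsd-print-x9`, LEAD `bsd-line-x10b-p1` g8; discharges the hypothesis `hOrth` of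
`eisensteinTower_isSelfOrthogonalAt_of_mem` (p669585) for the H.4 data of `exists_eisensteinDualityData[_unitTwist]` (clause (1):
`(D k).e = eisensteinDualityForm hm (k+1) (conjPairing (e (k+1)) τ_* (log (k+1)))`, clauses (4) alternating, (7) `τ_*` involutive,
(8) `log` bijective), canonical conjugation datum `ofLifts`, `E/ℚ` globally minimal with good ORDINARY reduction at `p`).

«`(D j).e` kills `(A_{m,j+1} ⊗ Fil_v E[p^{j+1}]) × δ_v·(A_{m,j+1} ⊗ Fil_{σv} E[p^{j+1}])`» — from x10b-p1-w7 g2's restricted-perfectness package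
`eisensteinDualityForm_torsionFilAt_restricted_perfect_of_isOrdinaryAt` (p666466: its isotropy clause), the non-degeneracy of the
Weil family read off `D.perfect` (x9-p1-w4 g7's `weilLog_nondegenerate_of_dualityDatum_e_eq`, p665348), and
`map_eisensteinTwist_span_tmul` (the twisted action carries `A ⊗ Fil` onto `A ⊗ δ_v·Fil`).

* **`WeierstrassCurve.eisensteinTower_orthogonal_twistedFil_of_e_eq`** — the binder `hOrth` of p669585, for every `v ∣ p`.
No summit statement is proved; BSD is not proved by any of this.

References: B. Howard, Compositio Math. 140 (2004), Lemma 3.1.1, §1.3 H.4, Rem. 1.3.2 (arXiv:1202.6340 p. 7, p. 15);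
J. H. Silverman, *AEC* (2009), III.8.1, VII.2; R. Greenberg, LNM 1716 (1999), §2.
-/

set_option autoImplicit false

noncomputable section

open Function NumberField IsDedekindDomain Field CategoryTheory
open scoped NumberField ContRepresentation TensorProduct Classical

namespace WeierstrassCurve

open Literature.NumberTheory.EllipticCurves Literature.NumberTheory.GaloisRepresentations
open Literature.NumberTheory.GaloisRepresentations.DiscreteGaloisModule
open Literature.NumberTheory.GaloisCohomology Literature.NumberTheory.GaloisCohomology.Howard2004
open Literature.NumberTheory.EllipticCurves.ZpExtension (EisensteinLevel)

variable {K : Type} [Field K] [NumberField K] (W : WeierstrassCurve ℚ) [W.IsElliptic] [W.IsGloballyMinimal]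
  {p : ℕ} [hp : Fact p.Prime] (κ : ZpExtension K p) {m : ℕ} (hm : 1 ≤ m)
  (σ : K ≃ₐ[ℚ] K) (hσ₁ : σ ≠ 1) (hσ : σ * σ = 1) (τ : AlgebraicClosure K ≃+* AlgebraicClosure K)
  (hτl : IsLiftOfAut σ τ) (hτ₂ : Function.Involutive τ)

set_option maxHeartbeats 800000 in
/-- **`hOrth` for the Weil–τ H.4 data at `v ∣ p`.**  Let `E/ℚ` be globally minimal with good ordinary reduction at `p`
(`IsOrdinaryAt W p`), `cd := ConjugationDatum.ofLifts σ … τ …`, and `D k` H.4 data on `T^{(k)}` with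
`(D k).e = eisensteinDualityForm hm (k+1) (conjPairing (e (k+1)) τ_* (log (k+1)))` for an alternating Weil family `e`, bijective
logarithms `log` and involutive `τ_*`.  Then for every `v ∣ p` and every `j`, `(D j).e s (δ_v · s′) = 0` for `s` in the twisted plus part
`A ⊗ Fil_v` and `s′` in `A ⊗ Fil_{σ v}` at level `j+1` — the hypothesis `hOrth` of `eisensteinTower_isSelfOrthogonalAt_of_mem`.
[cite: Howard2004HeegnerKolyvagin, Lemma 3.1.1 and §1.3 H.4 (arXiv p. 7 L69–82, p. 15 L60–62)] [cite: SilvermanAEC2009, III.8.1 and VII.2.2] -/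
theorem eisensteinTower_orthogonal_twistedFil_of_e_eq (hordW : IsOrdinaryAt W p)
    (D' : letI := IwasawaAlgebra.isLocalRing_quotient_X_pow_add_C p hm
      ∀ k, DualityDatum p (ConjugationDatum.ofLifts σ hσ₁ hσ τ hτl hτ₂) ((W.eisensteinTower κ hm).ρ k)
        (IwasawaAlgebra.EisensteinCoeff p m (k + 1)))
    (e : ∀ j : ℕ, geomTorsion (W.baseChange K) ((p : ℤ) ^ j) →+ geomTorsion (W.baseChange K) ((p : ℤ) ^ j) →+
      MuCarrier K (p ^ j))
    (log : ∀ j : ℕ, MuCarrier K (p ^ j) →+ ZMod (p ^ j))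
    (hDe : letI := IwasawaAlgebra.isLocalRing_quotient_X_pow_add_C p hm
      ∀ k, (D' k).e = ZpExtension.eisensteinDualityForm hm (k + 1)
        (conjPairing (e (k + 1)) ((ConjugationDatum.ofLifts σ hσ₁ hσ τ hτl hτ₂).isLift.torsionMap W _) (log (k + 1))))
    (halt : ∀ j a, e j a a = 0) (hlog : ∀ j, Function.Bijective (log j))
    (hθθ : ∀ j (a : geomTorsion (W.baseChange K) ((p : ℤ) ^ j)),
      (ConjugationDatum.ofLifts σ hσ₁ hσ τ hτl hτ₂).isLift.torsionMap W _
        ((ConjugationDatum.ofLifts σ hσ₁ hσ τ hτl hτ₂).isLift.torsionMap W _ a) = a)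
    {v : HeightOneSpectrum (𝓞 K)} (hpv : ((p : ℕ) : 𝓞 K) ∈ v.asIdeal) :
    letI := IwasawaAlgebra.isLocalRing_quotient_X_pow_add_C p hm
    ∀ j, ∀ s ∈ ((W.baseChange K).ordinaryFiltrationAt v (fun j ↦ (W.baseChange K).torsionGaloisModuleReduce p j)
        (fun _ _ ↦ rfl)).twistedFil (m := m) (j + 1),
      ∀ s' ∈ ((W.baseChange K).ordinaryFiltrationAt ((ConjugationDatum.ofLifts σ hσ₁ hσ τ hτl hτ₂).σ • v)
        (fun j ↦ (W.baseChange K).torsionGaloisModuleReduce p j) (fun _ _ ↦ rfl)).twistedFil (m := m) (j + 1),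
        (D' j).e s ((κ.eisensteinTwist ((W.baseChange K).torsionGaloisModule ((p : ℤ) ^ (j + 1))) hm (j + 1))
          ((ConjugationDatum.ofLifts σ hσ₁ hσ τ hτl hτ₂).δ v) s') = 0 := by
  letI := IwasawaAlgebra.isLocalRing_quotient_X_pow_add_C p hm
  intro j s hs s' hs'
  -- non-degeneracy of the Weil family from `D.perfect`
  have hnd := (W.weilLog_nondegenerate_of_dualityDatum_e_eq κ hm (ConjugationDatum.ofLifts σ hσ₁ hσ τ hτl hτ₂) j (D' j)
    (e (j + 1)) (log (j + 1)) (hDe j) (hθθ (j + 1))).2.2.2.2.2.2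
  -- the restricted isotropy clause of the Weil–τ form on `(A ⊗ Fil_v) × (A ⊗ δ_v Fil_{σv})`
  obtain ⟨horth, -, -⟩ := W.eisensteinDualityForm_torsionFilAt_restricted_perfect_of_isOrdinaryAt hm σ hσ₁ hσ τ hτl hτ₂
    hordW v hpv (j + 1) (e (j + 1)) (log (j + 1)) (hlog (j + 1)).1 (halt (j + 1)) hnd (hθθ (j + 1))
  rw [hDe j]
  refine horth s hs _ ?_
  -- `δ_v · s′` lies in `A ⊗ δ_v Fil_{σv}`
  have key := κ.map_eisensteinTwist_span_tmul ((W.baseChange K).torsionGaloisModule ((p : ℤ) ^ (j + 1))) hm (j + 1)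
    ((W.baseChange K).torsionFilAt ((ConjugationDatum.ofLifts σ hσ₁ hσ τ hτl hτ₂).σ • v) ((p : ℤ) ^ (j + 1)))
    ((ConjugationDatum.ofLifts σ hσ₁ hσ τ hτl hτ₂).δ v)
  have hmem : (κ.eisensteinTwist ((W.baseChange K).torsionGaloisModule ((p : ℤ) ^ (j + 1))) hm (j + 1)
        ((ConjugationDatum.ofLifts σ hσ₁ hσ τ hτl hτ₂).δ v)) s' ∈
      (Submodule.span ℤ {x | ∃ (c : IwasawaAlgebra.EisensteinCoeff p m (j + 1))
          (a : geomTorsion (W.baseChange K) ((p : ℤ) ^ (j + 1))),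
          a ∈ (W.baseChange K).torsionFilAt ((ConjugationDatum.ofLifts σ hσ₁ hσ τ hτl hτ₂).σ • v) ((p : ℤ) ^ (j + 1)) ∧
            x = IwasawaAlgebra.EisensteinCoeff.Twisted.tmul c a}).map
        (κ.eisensteinTwist ((W.baseChange K).torsionGaloisModule ((p : ℤ) ^ (j + 1))) hm (j + 1)
          ((ConjugationDatum.ofLifts σ hσ₁ hσ τ hτl hτ₂).δ v)) :=
    Submodule.mem_map_of_mem hs'
  rw [key] at hmem
  exact hmem

end WeierstrassCurve

end
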